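import Summits.ABC.ABC.Theses.FeketeScales
import Summits.ABC.ABC.Theorems.FeketeScalesSparseGoodScalesMinimalResidue
import HarnessLib

/-!
# Crux `SparseGoodScales` (stmt-ABC-2161) — line `SketchIdeator4` (minimal in-route residue
# `ScaleSubmultiplicativity × DroughtsOfSomeRatio`), lead prover's SKELETON v2 (composition imported)

Leads: prover-line-stmt-ABC-2161-a1-0 (v1, 2026-08-16, self-contained), prover-line-stmt-ABC-2161-c2-0
(v2, 2026-08-17: the composition is now IMPORTED from the landed
`Summits/ABC/ABC/Theorems/FeketeScalesSparseGoodScalesMinimalResidue.lean`, p111037, instead of being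
carried inline).  The crux (verbatim the route decl
`Summit.ABC.ABC.Theses.FeketeScales.SparseGoodScales`: for every `δ > 0` there are arbitrarily large
scales `R` with `c ≤ R^{1+δ}` for every abc triple of radical `≤ R`) is concluded BY NAME by
`sparseGoodScales_proof`, through
`Summit.ABC.ABC.Theorems.SparseGoodScales.sparseGoodScales_of_scaleSubmultiplicativity_of_droughts :
stub 1 → stub 2 → SparseGoodScales`.  `sorry` occurs only in the two registered stubs `stub_*`; every
stub is written in the tree's vocabulary (no definitions).

## The line (unchanged from v1; status as of the lead-c2 re-audit, 2026-08-17)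

* `stub_scaleSubmultiplicativity` (VERTICAL, regular variation): verbatim the sister crux
  `Summit.ABC.ABC.Theses.FeketeScales.ScaleSubmultiplicativity` (item stmt-ABC-2160).  STATUS:
  BLOCKED — lead a1 wave-1 worker `stub-blocked: stmt-ABC-2160`; 2160 is OPEN (2026-08-17: both its
  lines dead, its strategist census gen 1 = no strategy short of summit; implied by RST Conjecture A
  upper half via the landed `submultOfRST_proof`, not known to follow from ABC).
* `stub_droughtsOfSomeRatio` (HORIZONTAL, the bet; "DA∃"): for every `δ > 0` there is SOME ratio
  `Λ > 1` such that for every `N` some scale `R ≥ N` carries no abc triple with `rad ≤ R < rad^Λ` and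
  `c > rad^{1+δ}`.  STATUS: STUCK at `intro` — no engine: a proof needs either `O(log log X)`
  `(1+δ)`-exceptional radicals below `X` infinitely often (known: `X^{0.6+ε}` in the height aspect,
  `bernertEtAl2024_thm_1_3`; `X^{1+o(1)}` for radicals) or pairwise repulsion of exceptional radicals
  across varying supports (`Summit.ABC.ABC.Theorems.SparseGoodScales.droughtsOfSomeRatio_of_radicalRepulsion`,
  p107129 — hypothesis false at every accessible scale, vacuous under abc, no coupling object known);
  every first-moment / summable-shadow argument proves ABC outright (first-moment wall).  Implied by
  the crux, by WGS, by DA and by ABC (all landed); in-route `2160 → (DA∃ ↔ ABC)` (p111037).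

Disproof used: `Cruxes/SparseGoodScales/Disproof.lean` v2 (cdisprove c1): constrains `δ ≤ 0`,
`∀R`-strengthenings and dropped `IsABCTriple` clauses only; both stubs keep `δ > 0`, `∃ R ≥ N` and the
full `IsABCTriple`, so nothing there bites; no `-- Targets` theorem addresses either stub (both are
ABC-consequences: `droughtsOfSomeRatio_of_abc`, and 2160's own Disproof: "no kill possible").
-/

set_option linter.dupNamespace false

namespace Summit.ABC.ABC.Cruxes.SparseGoodScales.MinimalResidueLine

open Literature.NumberTheory.DiophantineGeometry
open Summit.ABC.ABC.Theses.FeketeScales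

/-! ## The two registered stubs -/

/-- **STUB 1 (vertical): scale sub-multiplicativity** — verbatim the sister crux
`Summit.ABC.ABC.Theses.FeketeScales.ScaleSubmultiplicativity` (item stmt-ABC-2160, open). -/
theorem stub_scaleSubmultiplicativity : ScaleSubmultiplicativity := by
  sorry

/-- **STUB 2 (horizontal, the bet): droughts of SOME ratio (DA∃).**  For every `δ > 0` there is a
ratio `Λ > 1` such that for every `N` some scale `R ≥ N` has NO abc triple with `rad ≤ R < rad^Λ`
and `c > rad^{1+δ}`. -/
theorem stub_droughtsOfSomeRatio :
    ∀ δ : ℝ, 0 < δ → ∃ Λ : ℝ, 1 < Λ ∧ ∀ N : ℕ, ∃ R : ℕ, N ≤ R ∧ ∀ a b c : ℕ,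
      IsABCTriple a b c → rad a b c ≤ R → (R : ℝ) < ((rad a b c : ℕ) : ℝ) ^ Λ →
        (c : ℝ) ≤ ((rad a b c : ℕ) : ℝ) ^ (1 + δ) := by
  sorry

/-! ## The crux, by name -/

/-- **The crux, concluded BY NAME from the two registered stubs** through the landed composition
`Summit.ABC.ABC.Theorems.SparseGoodScales.sparseGoodScales_of_scaleSubmultiplicativity_of_droughts`
(finitary Fekete escalation from drought scales + abc.S25, p111037). -/
theorem sparseGoodScales_proof : Theses.FeketeScales.SparseGoodScales :=
  Summit.ABC.ABC.Theorems.SparseGoodScales.sparseGoodScales_of_scaleSubmultiplicativity_of_droughts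
    stub_scaleSubmultiplicativity stub_droughtsOfSomeRatio

end Summit.ABC.ABC.Cruxes.SparseGoodScales.MinimalResidueLine
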